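import Summits.BirchSwinnertonDyer.BirchSwinnertonDyer.Theses.ShaPrimaryTransfer
import Literature.NumberTheory.EllipticCurves.KubertTate1718ShaFive
import Literature.NumberTheory.EllipticCurves.KubertTate15239ShaFive
import Literature.NumberTheory.EllipticCurves.KubertTate8687ShaFive
import Literature.NumberTheory.EllipticCurves.KubertTate34421ShaFive
import Literature.NumberTheory.EllipticCurves.KubertTate16883ShaFive
import Literature.NumberTheory.EllipticCurves.KubertTate289ShaFive
import Literature.NumberTheory.EllipticCurves.KubertTate2623ShaFive
import Summits.BirchSwinnertonDyer.BirchSwinnertonDyer.Theorems.ShaPrimaryTransferFiniteShaComponentTransferOddDoor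
import HarnessLib

/-!
# The door at `5` on the Kubert–Tate family: `T` by name at `p₀ = 5` on a rank-`2` and a RANK-`3` curve

Helper for item **stmt-BirchSwinnertonDyer-22356** (`FiniteShaComponentTransfer`, «T», the transfer slice
of route `ShaPrimaryTransfer`); it closes nothing by itself — `T` is conjecture-grade at analytic rank
`≥ 2` and **BSD is NOT proved by this file**. Sequel of `ShaPrimaryTransferFiniteShaComponentTransferDoorAtFiveDual`
(the curve `E_{13/14}`, rank `2`), now through the GENERIC `μ₅`-descent engine
(`Literature.….KubertTateMuDescent`, files `KubertTateFiveMuDescent[Box]`) and its instances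
`KubertTate1718Descent` / `KubertTate15239Descent`:

* §0 CLASS-WIDE on the tame family (`5 ∤ Δ`, no bad prime `≡ 1 (mod 5)`, a good prime `q ∈ {2,3,7,11}`, one
  rational point `P₁` with `25 P₁ ≠ O`): **`rank E_{m,n}(ℚ) + t₅(E_{m,n}) + 1 ≤ ω(mn)`** — the engine's first-descent
  bound `#Ш[5] · 5^{rank+1} ≤ 5^{ω(mn)}` (`KubertTateMuDescent.natCard_sha_torsionBy_five_mul_pow_le`) read through
  `#Ш[5] = 5^{t₅ + 2m}` (Cassels–Tate, a tree theorem: `ShaPrimaryTransferOddDoor.exists_natCard_sha_torsionBy_eq_pow`);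
  so `T`'s quantity `t₅` is bounded on the whole family by the number of prime factors of `mn`, and vanishes
  whenever the rank attains `ω(mn) − 1` (`shaCorank_five_eq_zero_of_rank`).
* `E₂ = E_{17/18} = [1, -306, -5508, 0, 0]` (`kubertTateFive 17 18`; rank `2`; `5` good ordinary, `a₅ = 1`):
  `shaCorank_five_E₂ : t₅(E₂) = 0`, `mordellWeilRank_E₂ : rank = 2`, `selmerCorank_five_E₂ : s₅(E₂) = 2`,
  **`transfer_at_five_E₂ : FiniteShaComponentTransfer → ∀ q, t_q(E₂) = 0`** (`T` BY NAME at the witness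
  prime `p₀ = 5`), `oneFiniteShaComponent_E₂` (the route's `O`/X1 shape, unconditional, witness `5`).
* `E₃ = E_{−152/39} = [191, 5928, 231192, 0, 0]` (`kubertTateFive (−152) 39`; **rank `3`**; `5` good ordinary
  anomalous, `a₅ = −4`): `shaCorank_five_E₃ : t₅(E₃) = 0`, `mordellWeilRank_E₃ : rank = 3`,
  `selmerCorank_five_E₃ : s₅(E₃) = 3`, **`transfer_at_five_E₃`**, `oneFiniteShaComponent_E₃` — the first
  curve of rank `3` in the tree with an unconditional `t_p = 0` at a good ordinary prime `p ≥ 5`, i.e. `T`'s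
  hypothesis met (and X2's conclusion `r_an ≤ s₅ = 3` reduced to `ord_{s=1} L(E₃, s) ≤ 3`) deeper inside
  the sector where no theorem in print supplies the finiteness of any other `Ш[q^∞]`.

* `E₃' = E_{−86/87} = [173, 7482, 650934, 0, 0]` (`kubertTateFive (−86) 87`; **rank `3`**; `a₅ = −4`; `S = {2,3,29,43}`,
  `m² − 11mn − n² = 82129` prime): `shaCorank_five_E₃'`, `mordellWeilRank_E₃'`, `transfer_at_five_E₃'`,
  `oneFiniteShaComponent_E₃'` — a second rank-`3` instance (the engine is not a one-off).

All statements are unconditional except those taking `hT : FiniteShaComponentTransfer`.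

## References

* [SilvermanAEC2009] J. H. Silverman, *AEC*, 2nd ed., Thm. X.4.2, Exercise 10.1.
* [Fisher2001FiveSevenDescent] T. Fisher, JEMS 3 (2001), §§1–2.
-/

noncomputable section

set_option linter.dupNamespace false

open WeierstrassCurve
open Literature.NumberTheory.EllipticCurves
open Summit.BirchSwinnertonDyer.BirchSwinnertonDyer.Theses.ShaPrimaryTransfer

namespace Summit.BirchSwinnertonDyer.BirchSwinnertonDyer.Theorems.ShaPrimaryTransferDoorAtFiveFamily

/-! ## §0 Class-wide: `rank + t₅ + 1 ≤ ω(mn)` on the tame Kubert–Tate family -/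

/-- **Class-wide Selmer-corank bound on the tame Kubert–Tate family**: for `E_{m,n}` elliptic with `5 ∤ Δ`,
no bad prime `≡ 1 (mod 5)`, a good prime `q ∈ {2, 3, 7, 11}` and a rational point `P₁` with `25 P₁ ≠ O`,
**`rank E_{m,n}(ℚ) + t₅(E_{m,n}) + 1 ≤ ω(mn)`** — unconditionally (first `5`-descent + Cassels–Tate, both tree
theorems). [cite: SilvermanAEC2009, Thm. X.4.2 and Prop. X.4.9] [cite: Fisher2001FiveSevenDescent, §2] -/
theorem rank_add_shaCorank_five_succ_le (m n : ℤ) [(kubertTateFive (m : ℚ) (n : ℚ)).IsElliptic]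
    (P₁ : geomPoints (kubertTateFive (m : ℚ) (n : ℚ)))
    (hP₁ : ∀ σ : Field.absoluteGaloisGroup ℚ, σ • P₁ = P₁) (h25 : ((25 : ℕ) : ℤ) • P₁ ≠ 0)
    (h5 : ¬ (5 : ℤ) ∣ (kubertTateFive m n).Δ)
    (h1 : ∀ p : ℕ, p.Prime → (p : ℤ) ∣ (kubertTateFive m n).Δ → p % 5 ≠ 1)
    (q : ℕ) [Fact q.Prime] (hq5 : q ≠ 5) (hq11 : 2 * q + 1 < 25) (hq : ¬ (q : ℤ) ∣ (kubertTateFive m n).Δ) :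
    (kubertTateFive (m : ℚ) (n : ℚ)).mordellWeilRank + (kubertTateFive (m : ℚ) (n : ℚ)).shaCorank 5 + 1 ≤
      (m * n).natAbs.primeFactors.card := by
  haveI : Fact (Nat.Prime 5) := ⟨Nat.prime_five⟩
  have h5tors := KubertTateFiveTorsion.natCard_torsionBy_five m n q hq5 hq11 hq
  have hb := KubertTateMuDescent.natCard_sha_torsionBy_five_mul_pow_le m n P₁ hP₁ h25 h5 h1 h5tors
  obtain ⟨k, hk⟩ := ShaPrimaryTransferOddDoor.exists_natCard_sha_torsionBy_eq_pow (kubertTateFive (m : ℚ) (n : ℚ)) 5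
  rw [hk, ← pow_add] at hb
  have := (Nat.pow_le_pow_iff_right (by norm_num : 1 < 5)).mp hb
  omega

/-- **… hence `t₅(E_{m,n}) = 0` whenever the rank attains the descent bound `ω(mn) − 1`** (class-wide, same
hypotheses). [cite: SilvermanAEC2009, Thm. X.4.2] [cite: Fisher2001FiveSevenDescent, §2] -/
theorem shaCorank_five_eq_zero_of_rank (m n : ℤ) [(kubertTateFive (m : ℚ) (n : ℚ)).IsElliptic]
    (P₁ : geomPoints (kubertTateFive (m : ℚ) (n : ℚ)))
    (hP₁ : ∀ σ : Field.absoluteGaloisGroup ℚ, σ • P₁ = P₁) (h25 : ((25 : ℕ) : ℤ) • P₁ ≠ 0)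
    (h5 : ¬ (5 : ℤ) ∣ (kubertTateFive m n).Δ)
    (h1 : ∀ p : ℕ, p.Prime → (p : ℤ) ∣ (kubertTateFive m n).Δ → p % 5 ≠ 1)
    (q : ℕ) [Fact q.Prime] (hq5 : q ≠ 5) (hq11 : 2 * q + 1 < 25) (hq : ¬ (q : ℤ) ∣ (kubertTateFive m n).Δ)
    (hr : (m * n).natAbs.primeFactors.card ≤ (kubertTateFive (m : ℚ) (n : ℚ)).mordellWeilRank + 1) :
    (kubertTateFive (m : ℚ) (n : ℚ)).shaCorank 5 = 0 := by
  have h := rank_add_shaCorank_five_succ_le m n P₁ hP₁ h25 h5 h1 q hq5 hq11 hq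
  omega

/-! ## §1 `E₂ = E_{17/18}` (rank `2`) -/

/-- **`t₅(E_{17/18}) = 0`, unconditionally** (generic `μ₅`-descent, three points). [cite: SilvermanAEC2009, Thm. X.4.2(a)] -/
theorem shaCorank_five_E₂ :
    haveI := KubertTate1718Descent.isElliptic
    (kubertTateFive (((17 : ℤ) : ℚ)) (((18 : ℤ) : ℚ))).shaCorank 5 = 0 :=
  KubertTate1718Descent.shaCorank_five_eq_zero

/-- **`rank E_{17/18}(ℚ) = 2`, unconditionally.** [cite: SilvermanAEC2009, Thm. X.4.2 and Thm. X.1.1] -/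
theorem mordellWeilRank_E₂ :
    haveI := KubertTate1718Descent.isElliptic
    (kubertTateFive (((17 : ℤ) : ℚ)) (((18 : ℤ) : ℚ))).mordellWeilRank = 2 :=
  KubertTate1718Descent.mordellWeilRank_eq

/-- **`s₅(E_{17/18}) = corank_{ℤ₅} Sel_{5^∞} = 2 = rank`** (`s_p = r + t_p`, tree
`selmerCorank_eq_mordellWeilRank_add_holds`). [cite: SilvermanAEC2009, Thm. X.4.2(b)] -/
theorem selmerCorank_five_E₂ :
    haveI := KubertTate1718Descent.isElliptic
    (kubertTateFive (((17 : ℤ) : ℚ)) (((18 : ℤ) : ℚ))).selmerCorank 5 = 2 := by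
  haveI := KubertTate1718Descent.isElliptic
  haveI : Fact (Nat.Prime 5) := ⟨Nat.prime_five⟩
  rw [(kubertTateFive (((17 : ℤ) : ℚ)) (((18 : ℤ) : ℚ))).selmerCorank_eq_mordellWeilRank_add_holds 5,
    shaCorank_five_E₂, mordellWeilRank_E₂]

/-- **`T` BY NAME at the witness prime `p₀ = 5` on `E_{17/18}`**: granting `FiniteShaComponentTransfer`,
`t_q(E_{17/18}) = 0` for EVERY prime `q`. [cite: SilvermanAEC2009, Thm. X.4.2(a)] -/
theorem transfer_at_five_E₂ (hT : FiniteShaComponentTransfer) (q : ℕ) [Fact q.Prime] :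
    haveI := KubertTate1718Descent.isElliptic
    (kubertTateFive (((17 : ℤ) : ℚ)) (((18 : ℤ) : ℚ))).shaCorank q = 0 :=
  haveI := KubertTate1718Descent.isElliptic
  haveI : Fact (Nat.Prime 5) := ⟨Nat.prime_five⟩
  hT _ 5 q shaCorank_five_E₂

/-- Under `T`: every `s_q(E_{17/18}) = 2 = rank`. [cite: SilvermanAEC2009, Thm. X.4.2(b)] -/
theorem selmerCorank_E₂_of_transfer (hT : FiniteShaComponentTransfer) (q : ℕ) [Fact q.Prime] :
    haveI := KubertTate1718Descent.isElliptic
    (kubertTateFive (((17 : ℤ) : ℚ)) (((18 : ℤ) : ℚ))).selmerCorank q = 2 := by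
  haveI := KubertTate1718Descent.isElliptic
  rw [(kubertTateFive (((17 : ℤ) : ℚ)) (((18 : ℤ) : ℚ))).selmerCorank_eq_mordellWeilRank_add_holds q,
    transfer_at_five_E₂ hT q, mordellWeilRank_E₂]

/-- **The route's `O = OneFiniteShaComponent` holds for `E_{17/18}`, witness `p₀ = 5`, unconditionally.**
[cite: SilvermanAEC2009, Thm. X.4.2(a)] -/
theorem oneFiniteShaComponent_E₂ :
    haveI := KubertTate1718Descent.isElliptic
    ∃ (p : ℕ) (_ : Fact p.Prime), (kubertTateFive (((17 : ℤ) : ℚ)) (((18 : ℤ) : ℚ))).shaCorank p = 0 :=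
  ⟨5, ⟨Nat.prime_five⟩, shaCorank_five_E₂⟩

/-! ## §2 `E₃ = E_{−152/39}` (rank `3`) -/

/-- **`t₅(E_{−152/39}) = 0`, unconditionally, at RANK `3`** (generic `μ₅`-descent, four points).
[cite: SilvermanAEC2009, Thm. X.4.2(a)] -/
theorem shaCorank_five_E₃ :
    haveI := KubertTate15239Descent.isElliptic
    (kubertTateFive (((-152 : ℤ) : ℚ)) (((39 : ℤ) : ℚ))).shaCorank 5 = 0 :=
  KubertTate15239Descent.shaCorank_five_eq_zero

/-- **`rank E_{−152/39}(ℚ) = 3`, unconditionally.** [cite: SilvermanAEC2009, Thm. X.4.2 and Thm. X.1.1] -/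
theorem mordellWeilRank_E₃ :
    haveI := KubertTate15239Descent.isElliptic
    (kubertTateFive (((-152 : ℤ) : ℚ)) (((39 : ℤ) : ℚ))).mordellWeilRank = 3 :=
  KubertTate15239Descent.mordellWeilRank_eq

/-- **`s₅(E_{−152/39}) = 3 = rank`.** [cite: SilvermanAEC2009, Thm. X.4.2(b)] -/
theorem selmerCorank_five_E₃ :
    haveI := KubertTate15239Descent.isElliptic
    (kubertTateFive (((-152 : ℤ) : ℚ)) (((39 : ℤ) : ℚ))).selmerCorank 5 = 3 := by
  haveI := KubertTate15239Descent.isElliptic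
  haveI : Fact (Nat.Prime 5) := ⟨Nat.prime_five⟩
  rw [(kubertTateFive (((-152 : ℤ) : ℚ)) (((39 : ℤ) : ℚ))).selmerCorank_eq_mordellWeilRank_add_holds 5,
    shaCorank_five_E₃, mordellWeilRank_E₃]

/-- **`T` BY NAME at the witness prime `p₀ = 5` on the RANK-`3` curve `E_{−152/39}`**: granting
`FiniteShaComponentTransfer`, `t_q(E_{−152/39}) = 0` for EVERY prime `q`. [cite: SilvermanAEC2009, Thm. X.4.2(a)] -/
theorem transfer_at_five_E₃ (hT : FiniteShaComponentTransfer) (q : ℕ) [Fact q.Prime] :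
    haveI := KubertTate15239Descent.isElliptic
    (kubertTateFive (((-152 : ℤ) : ℚ)) (((39 : ℤ) : ℚ))).shaCorank q = 0 :=
  haveI := KubertTate15239Descent.isElliptic
  haveI : Fact (Nat.Prime 5) := ⟨Nat.prime_five⟩
  hT _ 5 q shaCorank_five_E₃

/-- Under `T`: every `s_q(E_{−152/39}) = 3 = rank`. [cite: SilvermanAEC2009, Thm. X.4.2(b)] -/
theorem selmerCorank_E₃_of_transfer (hT : FiniteShaComponentTransfer) (q : ℕ) [Fact q.Prime] :
    haveI := KubertTate15239Descent.isElliptic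
    (kubertTateFive (((-152 : ℤ) : ℚ)) (((39 : ℤ) : ℚ))).selmerCorank q = 3 := by
  haveI := KubertTate15239Descent.isElliptic
  rw [(kubertTateFive (((-152 : ℤ) : ℚ)) (((39 : ℤ) : ℚ))).selmerCorank_eq_mordellWeilRank_add_holds q,
    transfer_at_five_E₃ hT q, mordellWeilRank_E₃]

/-- **The route's `O = OneFiniteShaComponent` holds for `E_{−152/39}` (rank `3`), witness `p₀ = 5`,
unconditionally.** [cite: SilvermanAEC2009, Thm. X.4.2(a)] -/
theorem oneFiniteShaComponent_E₃ :
    haveI := KubertTate15239Descent.isElliptic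
    ∃ (p : ℕ) (_ : Fact p.Prime), (kubertTateFive (((-152 : ℤ) : ℚ)) (((39 : ℤ) : ℚ))).shaCorank p = 0 :=
  ⟨5, ⟨Nat.prime_five⟩, shaCorank_five_E₃⟩

/-! ## §2b `E₃' = E_{−86/87}` (rank `3`, second instance) -/

/-- **`t₅(E_{−86/87}) = 0`, unconditionally, at RANK `3`.** [cite: SilvermanAEC2009, Thm. X.4.2(a)] -/
theorem shaCorank_five_E₃' :
    haveI := KubertTate8687Descent.isElliptic
    (kubertTateFive (((-86 : ℤ) : ℚ)) (((87 : ℤ) : ℚ))).shaCorank 5 = 0 :=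
  KubertTate8687Descent.shaCorank_five_eq_zero

/-- **`rank E_{−86/87}(ℚ) = 3`, unconditionally.** [cite: SilvermanAEC2009, Thm. X.4.2 and Thm. X.1.1] -/
theorem mordellWeilRank_E₃' :
    haveI := KubertTate8687Descent.isElliptic
    (kubertTateFive (((-86 : ℤ) : ℚ)) (((87 : ℤ) : ℚ))).mordellWeilRank = 3 :=
  KubertTate8687Descent.mordellWeilRank_eq

/-- **`T` BY NAME at `p₀ = 5` on the rank-`3` curve `E_{−86/87}`**: granting `FiniteShaComponentTransfer`,
`t_q(E_{−86/87}) = 0` for every prime `q`. [cite: SilvermanAEC2009, Thm. X.4.2(a)] -/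
theorem transfer_at_five_E₃' (hT : FiniteShaComponentTransfer) (q : ℕ) [Fact q.Prime] :
    haveI := KubertTate8687Descent.isElliptic
    (kubertTateFive (((-86 : ℤ) : ℚ)) (((87 : ℤ) : ℚ))).shaCorank q = 0 :=
  haveI := KubertTate8687Descent.isElliptic
  haveI : Fact (Nat.Prime 5) := ⟨Nat.prime_five⟩
  hT _ 5 q shaCorank_five_E₃'

/-- **The route's `O = OneFiniteShaComponent` holds for `E_{−86/87}` (rank `3`), witness `p₀ = 5`,
unconditionally.** [cite: SilvermanAEC2009, Thm. X.4.2(a)] -/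
theorem oneFiniteShaComponent_E₃' :
    haveI := KubertTate8687Descent.isElliptic
    ∃ (p : ℕ) (_ : Fact p.Prime), (kubertTateFive (((-86 : ℤ) : ℚ)) (((87 : ℤ) : ℚ))).shaCorank p = 0 :=
  ⟨5, ⟨Nat.prime_five⟩, shaCorank_five_E₃'⟩

/-! ## §3 Status -/

/-- **Status of the door at `5` on the family (g17)**: unconditionally `rank E₂ = 2`, `t₅(E₂) = 0`,
`s₅(E₂) = 2`, `rank E₃ = 3`, `t₅(E₃) = 0`, `s₅(E₃) = 3`; and `T ⟹ ∀ q, t_q(E₂) = t_q(E₃) = 0`.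
[cite: SilvermanAEC2009, Thm. X.4.2] [cite: Fisher2001FiveSevenDescent, §2] -/
theorem doorAtFive_family_open :
    haveI := KubertTate1718Descent.isElliptic
    haveI := KubertTate15239Descent.isElliptic
    (kubertTateFive (((17 : ℤ) : ℚ)) (((18 : ℤ) : ℚ))).mordellWeilRank = 2 ∧
    (kubertTateFive (((17 : ℤ) : ℚ)) (((18 : ℤ) : ℚ))).shaCorank 5 = 0 ∧
    (kubertTateFive (((17 : ℤ) : ℚ)) (((18 : ℤ) : ℚ))).selmerCorank 5 = 2 ∧
    (kubertTateFive (((-152 : ℤ) : ℚ)) (((39 : ℤ) : ℚ))).mordellWeilRank = 3 ∧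
    (kubertTateFive (((-152 : ℤ) : ℚ)) (((39 : ℤ) : ℚ))).shaCorank 5 = 0 ∧
    (kubertTateFive (((-152 : ℤ) : ℚ)) (((39 : ℤ) : ℚ))).selmerCorank 5 = 3 ∧
    (FiniteShaComponentTransfer → ∀ q : ℕ, [Fact q.Prime] →
      (kubertTateFive (((17 : ℤ) : ℚ)) (((18 : ℤ) : ℚ))).shaCorank q = 0 ∧
      (kubertTateFive (((-152 : ℤ) : ℚ)) (((39 : ℤ) : ℚ))).shaCorank q = 0) :=
  ⟨mordellWeilRank_E₂, shaCorank_five_E₂, selmerCorank_five_E₂, mordellWeilRank_E₃, shaCorank_five_E₃,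
    selmerCorank_five_E₃, fun hT q _ ↦ ⟨transfer_at_five_E₂ hT q, transfer_at_five_E₃ hT q⟩⟩

/-! ## §4 Class-wide, stated with the rank only (no named point) -/

section RankForm

/- `E(ℚ)` with the classical `DecidableEq ℚ`, the instance under which `WeierstrassCurve.mordellWeilRank` and
`toGeomPoints` are defined (tree `MordellWeil`, `SelmerCorankProofs`). -/
attribute [local instance 10000] Classical.propDecidable

/-- A curve of positive rank has a rational point `P` with `25 · ι(P) ≠ O` in `E(ℚ̄)` (else `E(ℚ)` is
`25`-torsion, so of rank `0`; Mathlib `Module.finrank_eq_zero_iff_isTorsion`). [folklore] -/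
private theorem exists_twentyfive_zsmul_toGeomPoints_ne_zero (W : WeierstrassCurve ℚ) [W.IsElliptic]
    (h : 1 ≤ W.mordellWeilRank) :
    ∃ P : W.toAffine.Point, ((25 : ℕ) : ℤ) • toGeomPoints W P ≠ 0 := by
  by_contra hcon
  have hcon' : ∀ P : W.toAffine.Point, ((25 : ℕ) : ℤ) • toGeomPoints W P = 0 :=
    fun P ↦ Classical.not_not.mp (not_exists.mp hcon P)
  haveI : Module.Finite ℤ W.toAffine.Point := by convert module_finite_point_holds W
  have htors : Module.IsTorsion ℤ W.toAffine.Point := by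
    intro P
    refine ⟨⟨((25 : ℕ) : ℤ), mem_nonZeroDivisors_of_ne_zero (by norm_num)⟩, ?_⟩
    change ((25 : ℕ) : ℤ) • P = 0
    apply toGeomPoints_injective W
    rw [(toGeomPoints W).map_zsmul, map_zero]
    exact hcon' P
  have h0 : Module.finrank ℤ W.toAffine.Point = 0 := Module.finrank_eq_zero_iff_isTorsion.mpr htors
  have hr : W.mordellWeilRank = Module.finrank ℤ W.toAffine.Point := by
    unfold WeierstrassCurve.mordellWeilRank; congr!
  rw [hr, h0] at h
  exact Nat.not_succ_le_zero 0 h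

end RankForm

/-- **Class-wide, rank form**: for a tame `E_{m,n}` (`5 ∤ Δ`, no bad prime `≡ 1 (mod 5)`) with a good prime
`q ∈ {2, 3, 7, 11}` and **positive rank**, `rank E_{m,n}(ℚ) + t₅(E_{m,n}) + 1 ≤ ω(mn)` — unconditionally.
[cite: SilvermanAEC2009, Thm. X.4.2 and Prop. X.4.9] [cite: Fisher2001FiveSevenDescent, §2] -/
theorem rank_add_shaCorank_five_succ_le_of_rank_pos (m n : ℤ) [(kubertTateFive (m : ℚ) (n : ℚ)).IsElliptic]
    (h5 : ¬ (5 : ℤ) ∣ (kubertTateFive m n).Δ)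
    (h1 : ∀ p : ℕ, p.Prime → (p : ℤ) ∣ (kubertTateFive m n).Δ → p % 5 ≠ 1)
    (q : ℕ) [Fact q.Prime] (hq5 : q ≠ 5) (hq11 : 2 * q + 1 < 25) (hq : ¬ (q : ℤ) ∣ (kubertTateFive m n).Δ)
    (hr : 1 ≤ (kubertTateFive (m : ℚ) (n : ℚ)).mordellWeilRank) :
    (kubertTateFive (m : ℚ) (n : ℚ)).mordellWeilRank + (kubertTateFive (m : ℚ) (n : ℚ)).shaCorank 5 + 1 ≤
      (m * n).natAbs.primeFactors.card := by
  obtain ⟨P, hP⟩ := exists_twentyfive_zsmul_toGeomPoints_ne_zero _ hr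
  exact rank_add_shaCorank_five_succ_le m n (toGeomPoints _ P) (fun σ ↦ smul_toGeomPoints _ σ P) hP h5 h1
    q hq5 hq11 hq

/-- **Class-wide `O` at the door**: a tame `E_{m,n}` with a good prime `q ∈ {2,3,7,11}` whose rank attains the
descent bound (`ω(mn) ≤ rank + 1`, rank `≥ 1`) satisfies the route's `OneFiniteShaComponent` shape with
witness `p₀ = 5`: `t₅(E_{m,n}) = 0`. [cite: SilvermanAEC2009, Thm. X.4.2] [cite: Fisher2001FiveSevenDescent, §2] -/
theorem oneFiniteShaComponent_of_rank (m n : ℤ) [(kubertTateFive (m : ℚ) (n : ℚ)).IsElliptic]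
    (h5 : ¬ (5 : ℤ) ∣ (kubertTateFive m n).Δ)
    (h1 : ∀ p : ℕ, p.Prime → (p : ℤ) ∣ (kubertTateFive m n).Δ → p % 5 ≠ 1)
    (q : ℕ) [Fact q.Prime] (hq5 : q ≠ 5) (hq11 : 2 * q + 1 < 25) (hq : ¬ (q : ℤ) ∣ (kubertTateFive m n).Δ)
    (hr : 1 ≤ (kubertTateFive (m : ℚ) (n : ℚ)).mordellWeilRank)
    (hω : (m * n).natAbs.primeFactors.card ≤ (kubertTateFive (m : ℚ) (n : ℚ)).mordellWeilRank + 1) :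
    ∃ (p : ℕ) (_ : Fact p.Prime), (kubertTateFive (m : ℚ) (n : ℚ)).shaCorank p = 0 := by
  refine ⟨5, ⟨Nat.prime_five⟩, ?_⟩
  have h := rank_add_shaCorank_five_succ_le_of_rank_pos m n h5 h1 q hq5 hq11 hq hr
  omega

/-! ## §5 Four more instances: `T` by name at `p₀ = 5` on `E_{−344/21}`, `E_{168/83}` (rank `3`), `E_{28/9}`, `E_{26/23}` (rank `2`) -/

/-- **`T` BY NAME at `p₀ = 5` on `E_{−344/21} = [365, 7224, 151704, 0, 0]`** (rank `3`, `t₅ = 0` unconditional by the `μ₅`-descent box,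
tree `KubertTate34421Descent`): granting `FiniteShaComponentTransfer`, `t_q = 0` for every prime `q`. [cite: SilvermanAEC2009, Thm. X.4.2(a)] -/
theorem transfer_at_five_E₄ (hT : FiniteShaComponentTransfer) (q : ℕ) [Fact q.Prime] :
    haveI := KubertTate34421Descent.isElliptic
    (kubertTateFive (((-344 : ℤ) : ℚ)) (((21 : ℤ) : ℚ))).shaCorank q = 0 :=
  haveI := KubertTate34421Descent.isElliptic
  haveI : Fact (Nat.Prime 5) := ⟨Nat.prime_five⟩
  hT _ 5 q KubertTate34421Descent.shaCorank_five_eq_zero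

/-- **The route's `O` holds for `E_{−344/21} = [365, 7224, 151704, 0, 0]`** (rank `3`), witness `p₀ = 5`, unconditionally; and its rank is
`3`. [cite: SilvermanAEC2009, Thm. X.4.2(a)] -/
theorem oneFiniteShaComponent_E₄ :
    haveI := KubertTate34421Descent.isElliptic
    (∃ (p : ℕ) (_ : Fact p.Prime), (kubertTateFive (((-344 : ℤ) : ℚ)) (((21 : ℤ) : ℚ))).shaCorank p = 0) ∧ (kubertTateFive (((-344 : ℤ) : ℚ)) (((21 : ℤ) : ℚ))).mordellWeilRank = 3 :=
  ⟨⟨5, ⟨Nat.prime_five⟩, KubertTate34421Descent.shaCorank_five_eq_zero⟩, KubertTate34421Descent.mordellWeilRank_eq⟩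

/-- **`T` BY NAME at `p₀ = 5` on `E_{168/83} = [−85, −13944, −1157352, 0, 0]`** (rank `3`, `t₅ = 0` unconditional by the `μ₅`-descent box,
tree `KubertTate16883Descent`): granting `FiniteShaComponentTransfer`, `t_q = 0` for every prime `q`. [cite: SilvermanAEC2009, Thm. X.4.2(a)] -/
theorem transfer_at_five_E₅ (hT : FiniteShaComponentTransfer) (q : ℕ) [Fact q.Prime] :
    haveI := KubertTate16883Descent.isElliptic
    (kubertTateFive (((168 : ℤ) : ℚ)) (((83 : ℤ) : ℚ))).shaCorank q = 0 :=
  haveI := KubertTate16883Descent.isElliptic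
  haveI : Fact (Nat.Prime 5) := ⟨Nat.prime_five⟩
  hT _ 5 q KubertTate16883Descent.shaCorank_five_eq_zero

/-- **The route's `O` holds for `E_{168/83} = [−85, −13944, −1157352, 0, 0]`** (rank `3`), witness `p₀ = 5`, unconditionally; and its rank is
`3`. [cite: SilvermanAEC2009, Thm. X.4.2(a)] -/
theorem oneFiniteShaComponent_E₅ :
    haveI := KubertTate16883Descent.isElliptic
    (∃ (p : ℕ) (_ : Fact p.Prime), (kubertTateFive (((168 : ℤ) : ℚ)) (((83 : ℤ) : ℚ))).shaCorank p = 0) ∧ (kubertTateFive (((168 : ℤ) : ℚ)) (((83 : ℤ) : ℚ))).mordellWeilRank = 3 :=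
  ⟨⟨5, ⟨Nat.prime_five⟩, KubertTate16883Descent.shaCorank_five_eq_zero⟩, KubertTate16883Descent.mordellWeilRank_eq⟩

/-- **`T` BY NAME at `p₀ = 5` on `E_{28/9} = [−19, −252, −2268, 0, 0]`** (rank `2`, `t₅ = 0` unconditional by the `μ₅`-descent box,
tree `KubertTate289Descent`): granting `FiniteShaComponentTransfer`, `t_q = 0` for every prime `q`. [cite: SilvermanAEC2009, Thm. X.4.2(a)] -/
theorem transfer_at_five_E₆ (hT : FiniteShaComponentTransfer) (q : ℕ) [Fact q.Prime] :
    haveI := KubertTate289Descent.isElliptic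
    (kubertTateFive (((28 : ℤ) : ℚ)) (((9 : ℤ) : ℚ))).shaCorank q = 0 :=
  haveI := KubertTate289Descent.isElliptic
  haveI : Fact (Nat.Prime 5) := ⟨Nat.prime_five⟩
  hT _ 5 q KubertTate289Descent.shaCorank_five_eq_zero

/-- **The route's `O` holds for `E_{28/9} = [−19, −252, −2268, 0, 0]`** (rank `2`), witness `p₀ = 5`, unconditionally; and its rank is
`2`. [cite: SilvermanAEC2009, Thm. X.4.2(a)] -/
theorem oneFiniteShaComponent_E₆ :
    haveI := KubertTate289Descent.isElliptic
    (∃ (p : ℕ) (_ : Fact p.Prime), (kubertTateFive (((28 : ℤ) : ℚ)) (((9 : ℤ) : ℚ))).shaCorank p = 0) ∧ (kubertTateFive (((28 : ℤ) : ℚ)) (((9 : ℤ) : ℚ))).mordellWeilRank = 2 :=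
  ⟨⟨5, ⟨Nat.prime_five⟩, KubertTate289Descent.shaCorank_five_eq_zero⟩, KubertTate289Descent.mordellWeilRank_eq⟩

/-- **`T` BY NAME at `p₀ = 5` on `E_{26/23} = [−3, −598, −13754, 0, 0]`** (rank `2`, `t₅ = 0` unconditional by the `μ₅`-descent box,
tree `KubertTate2623Descent`): granting `FiniteShaComponentTransfer`, `t_q = 0` for every prime `q`. [cite: SilvermanAEC2009, Thm. X.4.2(a)] -/
theorem transfer_at_five_E₇ (hT : FiniteShaComponentTransfer) (q : ℕ) [Fact q.Prime] :
    haveI := KubertTate2623Descent.isElliptic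
    (kubertTateFive (((26 : ℤ) : ℚ)) (((23 : ℤ) : ℚ))).shaCorank q = 0 :=
  haveI := KubertTate2623Descent.isElliptic
  haveI : Fact (Nat.Prime 5) := ⟨Nat.prime_five⟩
  hT _ 5 q KubertTate2623Descent.shaCorank_five_eq_zero

/-- **The route's `O` holds for `E_{26/23} = [−3, −598, −13754, 0, 0]`** (rank `2`), witness `p₀ = 5`, unconditionally; and its rank is
`2`. [cite: SilvermanAEC2009, Thm. X.4.2(a)] -/
theorem oneFiniteShaComponent_E₇ :
    haveI := KubertTate2623Descent.isElliptic
    (∃ (p : ℕ) (_ : Fact p.Prime), (kubertTateFive (((26 : ℤ) : ℚ)) (((23 : ℤ) : ℚ))).shaCorank p = 0) ∧ (kubertTateFive (((26 : ℤ) : ℚ)) (((23 : ℤ) : ℚ))).mordellWeilRank = 2 :=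
  ⟨⟨5, ⟨Nat.prime_five⟩, KubertTate2623Descent.shaCorank_five_eq_zero⟩, KubertTate2623Descent.mordellWeilRank_eq⟩

end Summit.BirchSwinnertonDyer.BirchSwinnertonDyer.Theorems.ShaPrimaryTransferDoorAtFiveFamily

end
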